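import Summits.QuantumAdvantage.QuantumAdvantage.Theorems.CharDialBlockDialC
import HarnessLib

/-!
# The block dial, part D: the constant-block tail (moment method at z = 1/2) (decomp-qadv lens-6 g17 «OrbitDial», tree part 30P)

`Σ_u (1/2)^{# constant blocks of u among the first j} ≤ 2ⁿ (1 − 2^{−p})^j` (`sum_Zw_le`) by the weighted subcube double count `sum_sum_merge` on block `j`
(the factor `Σ_a (1/2)^{[a constant on block j]} ≤ 2ⁿ(1 − 2^{−p})` from the two constant sub-cubes, `two_pow_le_card_isConst`, `sum_cfac_le`);
Markov and `qpow_le_half : (1 − 2^{−p})^{2^p} ≤ e^{−1} ≤ 1/2` give ★ `card_few_const_le_half`: with `M ≥ 2^p (T+1)` separated blocks at most `2ⁿ/2`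
inputs have `≤ T` constant blocks.
Supports item stmt-QuantumAdvantage-32604 (`CharDial.WalkHardFJLinOdd`); source: pub annex g17/OrbitDial37.lean §37q REV12 (sha256 7a2cb935…), namespace `…Theses.OrbitDial.BlockDial`, statements and proofs verbatim with the Prop abbreviations `InBlk`/`IsConst`/`BlkSep` INLINED (Prop-free twin).
-/

set_option autoImplicit false

namespace Summit.QuantumAdvantage.AdviceFreeQNC0.JLinPeel.BlockDial

open Finset
open Summit.QuantumAdvantage.AdviceFreeQNC0
open Literature.Computability.MetaComplexity Literature.Computability.MetaComplexity.Smolensky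

section BlockTail
open Classical
variable {n M : ℕ} {p : ℕ} {S : Fin M → ℕ}


/-! #### the constant-block TAIL: most inputs have many constant blocks (moment method at `z = 1/2`) -/

/-- weighted subcube double count: `Σ_a Σ_u f (merge_W a u) = 2ⁿ · Σ_w f w`. -/
theorem sum_sum_merge (W : Finset (Fin n)) (f : (Fin n → Bool) → ℝ) :
    ∑ a : Fin n → Bool, ∑ u : Fin n → Bool, f (AffBells22.subcubeMerge W a u) = (2 : ℝ) ^ n * ∑ w : Fin n → Bool, f w := by
  let Φ : (Fin n → Bool) × (Fin n → Bool) → (Fin n → Bool) × (Fin n → Bool) :=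
    fun q => (AffBells22.subcubeMerge W q.1 q.2, AffBells22.subcubeMerge W q.2 q.1)
  have hΦ : Function.Involutive Φ := by
    rintro ⟨a, u⟩
    simp only [Φ, Prod.mk.injEq]
    refine ⟨?_, ?_⟩ <;> funext i <;> by_cases hi : i ∈ W <;> simp [AffBells22.subcubeMerge, hi]
  have h3 : (∑ a : Fin n → Bool, ∑ u : Fin n → Bool, f (AffBells22.subcubeMerge W a u))
      = ∑ q : (Fin n → Bool) × (Fin n → Bool), f (AffBells22.subcubeMerge W q.1 q.2) :=
    (Fintype.sum_prod_type' (fun a u => f (AffBells22.subcubeMerge W a u))).symm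
  have h2 := hΦ.bijective.sum_comp (fun q : (Fin n → Bool) × (Fin n → Bool) => f q.1)
  rw [h3]
  rw [show (∑ q : (Fin n → Bool) × (Fin n → Bool), f (AffBells22.subcubeMerge W q.1 q.2))
      = ∑ q : (Fin n → Bool) × (Fin n → Bool), f q.1 from h2]
  rw [Fintype.sum_prod_type, Finset.mul_sum]
  refine Finset.sum_congr rfl fun a _ => ?_
  show (∑ _u : Fin n → Bool, f a) = _
  rw [Finset.sum_const, Finset.card_univ, Fintype.card_fun, Fintype.card_bool, Fintype.card_fin, nsmul_eq_mul]
  push_cast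
  ring

/-- constant blocks among the first `j`. -/
noncomputable def cblkLT (p : ℕ) (S : Fin M → ℕ) (j : ℕ) (u : Fin n → Bool) : Finset (Fin M) :=
  univ.filter fun k => k.val < j ∧ (∀ x₁ x₂ : Fin n, (S k ≤ x₁.val ∧ x₁.val < S k + p) → (S k ≤ x₂.val ∧ x₂.val < S k + p) → u x₁ = u x₂)

/-- the half-weight `(1/2)^{# constant blocks among the first j}` (moment generating function at `z = 1/2`). -/
noncomputable def Zw (p : ℕ) (S : Fin M → ℕ) (j : ℕ) (u : Fin n → Bool) : ℝ := (1 / 2 : ℝ) ^ (cblkLT p S j u).card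

/-- no blocks before index `0`. -/
theorem cblkLT_zero (u : Fin n → Bool) : cblkLT p S 0 u = ∅ := by
  unfold cblkLT
  rw [Finset.filter_eq_empty_iff]
  rintro k - ⟨hk, -⟩
  omega

/-- all `M` blocks are before index `M`. -/
theorem cblkLT_M (u : Fin n → Bool) : cblkLT p S M u = cblk p S u := by
  unfold cblkLT cblk
  refine Finset.filter_congr fun k _ => ?_
  exact ⟨fun h => h.2, fun h => ⟨k.isLt, h⟩⟩

/-- one more block: the count of constant blocks grows by the indicator of block `j`. -/
theorem card_cblkLT_succ {j : ℕ} (hj : j < M) (u : Fin n → Bool) :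
    (cblkLT p S (j + 1) u).card = (cblkLT p S j u).card + (if (∀ x₁ x₂ : Fin n, (S ⟨j, hj⟩ ≤ x₁.val ∧ x₁.val < S ⟨j, hj⟩ + p) → (S ⟨j, hj⟩ ≤ x₂.val ∧ x₂.val < S ⟨j, hj⟩ + p) → u x₁ = u x₂) then 1 else 0) := by
  by_cases hc : (∀ x₁ x₂ : Fin n, (S ⟨j, hj⟩ ≤ x₁.val ∧ x₁.val < S ⟨j, hj⟩ + p) → (S ⟨j, hj⟩ ≤ x₂.val ∧ x₂.val < S ⟨j, hj⟩ + p) → u x₁ = u x₂)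
  · rw [if_pos hc]
    have e : cblkLT p S (j + 1) u = insert ⟨j, hj⟩ (cblkLT p S j u) := by
      ext k
      rw [cblkLT, cblkLT, mem_insert, mem_filter, mem_filter, Fin.ext_iff]
      simp only [mem_univ, true_and]
      constructor
      · rintro ⟨hk, hck⟩
        by_cases hkj : k.val = j
        · exact Or.inl hkj
        · exact Or.inr ⟨by omega, hck⟩
      · rintro (hkj | ⟨hk, hck⟩)
        · refine ⟨by omega, ?_⟩
          have hkk : k = ⟨j, hj⟩ := Fin.ext hkj
          rw [hkk]
          exact hc
        · exact ⟨by omega, hck⟩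
    have hnot : (⟨j, hj⟩ : Fin M) ∉ cblkLT p S j u := by
      rw [cblkLT, mem_filter]
      simp
    rw [e, Finset.card_insert_of_notMem hnot]
  · rw [if_neg hc, add_zero]
    congr 1
    ext k
    rw [cblkLT, cblkLT, mem_filter, mem_filter]
    simp only [mem_univ, true_and]
    constructor
    · rintro ⟨hk, hck⟩
      refine ⟨?_, hck⟩
      by_contra hkj
      have hkk : k = ⟨j, hj⟩ := Fin.ext (by simp; omega)
      rw [hkk] at hck
      exact hc hck
    · rintro ⟨hk, hck⟩
      exact ⟨by omega, hck⟩

/-- merging foreign bits into block `k₀` does not change constancy of the other blocks. -/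
theorem isConst_merge_of_ne (h : ((∀ k k', k < k' → S k + p ≤ S k') ∧ (∀ k, S k + p ≤ n))) {k k₀ : Fin M} (hk : k ≠ k₀) (a u : Fin n → Bool) :
    (∀ x₁ x₂ : Fin n, (S k ≤ x₁.val ∧ x₁.val < S k + p) → (S k ≤ x₂.val ∧ x₂.val < S k + p) → (AffBells22.subcubeMerge (blk p S k₀) a u) x₁ = (AffBells22.subcubeMerge (blk p S k₀) a u) x₂) ↔ (∀ x₁ x₂ : Fin n, (S k ≤ x₁.val ∧ x₁.val < S k + p) → (S k ≤ x₂.val ∧ x₂.val < S k + p) → u x₁ = u x₂) := by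
  have hagree : ∀ i, (S k ≤ i.val ∧ i.val < S k + p) → AffBells22.subcubeMerge (blk p S k₀) a u i = u i := by
    intro i hi
    unfold AffBells22.subcubeMerge
    rw [if_neg]
    intro hmem
    exact hk (inBlk_unique h hi (mem_blk.mp hmem))
  constructor
  · intro hc i i' hi hi'
    rw [← hagree i hi, ← hagree i' hi']
    exact hc i i' hi hi'
  · intro hc i i' hi hi'
    rw [hagree i hi, hagree i' hi']
    exact hc i i' hi hi'

/-- … while block `k₀` itself becomes constant iff the merged-in bits are. -/
theorem isConst_merge_self (k₀ : Fin M) (a u : Fin n → Bool) :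
    (∀ x₁ x₂ : Fin n, (S k₀ ≤ x₁.val ∧ x₁.val < S k₀ + p) → (S k₀ ≤ x₂.val ∧ x₂.val < S k₀ + p) → (AffBells22.subcubeMerge (blk p S k₀) a u) x₁ = (AffBells22.subcubeMerge (blk p S k₀) a u) x₂) ↔ (∀ x₁ x₂ : Fin n, (S k₀ ≤ x₁.val ∧ x₁.val < S k₀ + p) → (S k₀ ≤ x₂.val ∧ x₂.val < S k₀ + p) → a x₁ = a x₂) := by
  have hagree : ∀ i, (S k₀ ≤ i.val ∧ i.val < S k₀ + p) → AffBells22.subcubeMerge (blk p S k₀) a u i = a i := by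
    intro i hi
    unfold AffBells22.subcubeMerge
    rw [if_pos (mem_blk.mpr hi)]
  constructor
  · intro hc i i' hi hi'
    rw [← hagree i hi, ← hagree i' hi']
    exact hc i i' hi hi'
  · intro hc i i' hi hi'
    rw [hagree i hi, hagree i' hi']
    exact hc i i' hi hi'

/-- merging foreign bits into block `k₀` does not change which EARLIER blocks are constant. -/
theorem cblkLT_merge (h : ((∀ k k', k < k' → S k + p ≤ S k') ∧ (∀ k, S k + p ≤ n))) {j : ℕ} {k₀ : Fin M} (hj : j ≤ k₀.val) (a u : Fin n → Bool) :
    cblkLT p S j (AffBells22.subcubeMerge (blk p S k₀) a u) = cblkLT p S j u := by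
  unfold cblkLT
  refine Finset.filter_congr fun k _ => ?_
  have hne : k.val < j → k ≠ k₀ := by
    intro hk e
    rw [e] at hk
    omega
  constructor
  · rintro ⟨hk, hc⟩
    exact ⟨hk, (isConst_merge_of_ne h (hne hk) a u).mp hc⟩
  · rintro ⟨hk, hc⟩
    exact ⟨hk, (isConst_merge_of_ne h (hne hk) a u).mpr hc⟩

/-- the half-weight factorises over «block `j`» × «blocks before `j`». -/
theorem Zw_succ_merge (h : ((∀ k k', k < k' → S k + p ≤ S k') ∧ (∀ k, S k + p ≤ n))) {j : ℕ} (hj : j < M) (a u : Fin n → Bool) :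
    Zw p S (j + 1) (AffBells22.subcubeMerge (blk p S ⟨j, hj⟩) a u)
      = Zw p S j u * (if (∀ x₁ x₂ : Fin n, (S ⟨j, hj⟩ ≤ x₁.val ∧ x₁.val < S ⟨j, hj⟩ + p) → (S ⟨j, hj⟩ ≤ x₂.val ∧ x₂.val < S ⟨j, hj⟩ + p) → a x₁ = a x₂) then (1 / 2 : ℝ) else 1) := by
  unfold Zw
  rw [card_cblkLT_succ hj, cblkLT_merge h (j := j) (k₀ := ⟨j, hj⟩) (le_refl j) a u, pow_add]
  congr 1
  by_cases hc : (∀ x₁ x₂ : Fin n, (S ⟨j, hj⟩ ≤ x₁.val ∧ x₁.val < S ⟨j, hj⟩ + p) → (S ⟨j, hj⟩ ≤ x₂.val ∧ x₂.val < S ⟨j, hj⟩ + p) → a x₁ = a x₂)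
  · rw [if_pos ((isConst_merge_self ⟨j, hj⟩ a u).mpr hc), if_pos hc, pow_one]
  · rw [if_neg (fun hh => hc ((isConst_merge_self ⟨j, hj⟩ a u).mp hh)), if_neg hc, pow_zero]

/-- at least `2·2^{n−p}` inputs are constant on a given block (the two constant sub-cubes). -/
theorem two_pow_le_card_isConst (h : ((∀ k k', k < k' → S k + p ≤ S k') ∧ (∀ k, S k + p ≤ n))) (hp : 1 ≤ p) (k : Fin M) :
    2 * 2 ^ (n - p) ≤ (univ.filter fun a : Fin n → Bool => (∀ x₁ x₂ : Fin n, (S k ≤ x₁.val ∧ x₁.val < S k + p) → (S k ≤ x₂.val ∧ x₂.val < S k + p) → a x₁ = a x₂)).card := by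
  set B : Finset (Fin n) := blk p S k with hB
  have hBc : B.card = p := card_blk h k
  let img : Bool → Finset (Fin n → Bool) := fun b => univ.image (Subcube.ext B (fun _ => b))
  have hinj : ∀ b : Bool, Function.Injective (Subcube.ext B (fun _ : Fin n => b)) := fun b =>
    Function.LeftInverse.injective fun v => Subcube.res_ext B (fun _ => b) v
  have hcard : ∀ b, (img b).card = 2 ^ (n - p) := by
    intro b
    show (univ.image (Subcube.ext B (fun _ => b))).card = _
    rw [Finset.card_image_of_injective _ (hinj b), card_univ, Fintype.card_fun, Fintype.card_bool, Fintype.card_fin, hBc]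
  have hsub : ∀ b, img b ⊆ univ.filter fun a : Fin n → Bool => (∀ x₁ x₂ : Fin n, (S k ≤ x₁.val ∧ x₁.val < S k + p) → (S k ≤ x₂.val ∧ x₂.val < S k + p) → a x₁ = a x₂) := by
    intro b a ha
    rw [mem_filter]
    refine ⟨mem_univ _, ?_⟩
    obtain ⟨v, _, rfl⟩ := Finset.mem_image.mp ha
    intro i i' hi hi'
    rw [Subcube.ext_of_mem B _ v (mem_blk.mpr hi), Subcube.ext_of_mem B _ v (mem_blk.mpr hi')]
  have hdisj : Disjoint (img true) (img false) := by
    rw [Finset.disjoint_left]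
    intro a ha hb
    obtain ⟨v, _, hv⟩ := Finset.mem_image.mp ha
    obtain ⟨v', _, hv'⟩ := Finset.mem_image.mp hb
    obtain ⟨i, hi⟩ := exists_inBlk h hp k
    have e1 : a i = true := by rw [← hv, Subcube.ext_of_mem B _ v (mem_blk.mpr hi)]
    have e2 : a i = false := by rw [← hv', Subcube.ext_of_mem B _ v' (mem_blk.mpr hi)]
    rw [e1] at e2
    exact Bool.noConfusion e2
  have hu := Finset.card_union_add_card_inter (img true) (img false)
  rw [Finset.disjoint_iff_inter_eq_empty.mp hdisj, Finset.card_empty, add_zero, hcard, hcard] at hu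
  calc 2 * 2 ^ (n - p) = (img true ∪ img false).card := by rw [hu]; ring
    _ ≤ _ := card_le_card (union_subset (hsub true) (hsub false))

/-- the block-`k` factor averages to at most `1 − 2^{−p}`. -/
theorem sum_cfac_le (h : ((∀ k k', k < k' → S k + p ≤ S k') ∧ (∀ k, S k + p ≤ n))) (hp : 1 ≤ p) (k : Fin M) :
    ∑ a : Fin n → Bool, (if (∀ x₁ x₂ : Fin n, (S k ≤ x₁.val ∧ x₁.val < S k + p) → (S k ≤ x₂.val ∧ x₂.val < S k + p) → a x₁ = a x₂) then (1 / 2 : ℝ) else 1) ≤ (2 : ℝ) ^ n * (1 - (1 / 2 : ℝ) ^ p) := by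
  rw [Finset.sum_ite, Finset.sum_const, Finset.sum_const, nsmul_eq_mul, nsmul_eq_mul, mul_one]
  have htot : ((univ.filter fun a : Fin n → Bool => (∀ x₁ x₂ : Fin n, (S k ≤ x₁.val ∧ x₁.val < S k + p) → (S k ≤ x₂.val ∧ x₂.val < S k + p) → a x₁ = a x₂)).card : ℝ)
      + ((univ.filter fun a : Fin n → Bool => ¬ (∀ x₁ x₂ : Fin n, (S k ≤ x₁.val ∧ x₁.val < S k + p) → (S k ≤ x₂.val ∧ x₂.val < S k + p) → a x₁ = a x₂)).card : ℝ) = (2 : ℝ) ^ n := by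
    have e := Finset.card_filter_add_card_filter_not (s := (univ : Finset (Fin n → Bool)))
      (fun a : Fin n → Bool => (∀ x₁ x₂ : Fin n, (S k ≤ x₁.val ∧ x₁.val < S k + p) → (S k ≤ x₂.val ∧ x₂.val < S k + p) → a x₁ = a x₂))
    rw [card_univ, Fintype.card_fun, Fintype.card_bool, Fintype.card_fin] at e
    exact_mod_cast e
  have hlow : (2 : ℝ) * (2 : ℝ) ^ (n - p) ≤ ((univ.filter fun a : Fin n → Bool => (∀ x₁ x₂ : Fin n, (S k ≤ x₁.val ∧ x₁.val < S k + p) → (S k ≤ x₂.val ∧ x₂.val < S k + p) → a x₁ = a x₂)).card : ℝ) := by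
    exact_mod_cast two_pow_le_card_isConst h hp k
  have hpn : p ≤ n := by have := h.2 k; omega
  have hsplit : (2 : ℝ) ^ n * (1 / 2 : ℝ) ^ p = (2 : ℝ) ^ (n - p) := by
    have e : (2 : ℝ) ^ n = (2 : ℝ) ^ (n - p) * (2 : ℝ) ^ p := by rw [← pow_add, Nat.sub_add_cancel hpn]
    rw [e, mul_assoc, ← mul_pow]
    norm_num
  rw [mul_sub, mul_one, hsplit]
  linarith

/-- the moment recursion `Σ Z_{j+1} ≤ (1 − 2^{−p}) Σ Z_j`. -/
theorem sum_Zw_succ_le (h : ((∀ k k', k < k' → S k + p ≤ S k') ∧ (∀ k, S k + p ≤ n))) (hp : 1 ≤ p) {j : ℕ} (hj : j < M) :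
    ∑ w : Fin n → Bool, Zw p S (j + 1) w ≤ (1 - (1 / 2 : ℝ) ^ p) * ∑ u : Fin n → Bool, Zw p S j u := by
  have key := sum_sum_merge (n := n) (blk p S ⟨j, hj⟩) (Zw p S (j + 1))
  have e : (∑ a : Fin n → Bool, ∑ u : Fin n → Bool, Zw p S (j + 1) (AffBells22.subcubeMerge (blk p S ⟨j, hj⟩) a u))
      = (∑ a : Fin n → Bool, (if (∀ x₁ x₂ : Fin n, (S ⟨j, hj⟩ ≤ x₁.val ∧ x₁.val < S ⟨j, hj⟩ + p) → (S ⟨j, hj⟩ ≤ x₂.val ∧ x₂.val < S ⟨j, hj⟩ + p) → a x₁ = a x₂) then (1 / 2 : ℝ) else 1)) * ∑ u : Fin n → Bool, Zw p S j u := by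
    rw [Finset.sum_mul_sum]
    refine Finset.sum_congr rfl fun a _ => Finset.sum_congr rfl fun u _ => ?_
    rw [Zw_succ_merge h hj, mul_comm]
  rw [e] at key
  have hZ : 0 ≤ ∑ u : Fin n → Bool, Zw p S j u := Finset.sum_nonneg fun u _ => by unfold Zw; positivity
  have hc := sum_cfac_le h hp ⟨j, hj⟩
  have h2n : (0 : ℝ) < (2 : ℝ) ^ n := by positivity
  have hmain : (2 : ℝ) ^ n * ∑ w : Fin n → Bool, Zw p S (j + 1) w
      ≤ (2 : ℝ) ^ n * ((1 - (1 / 2 : ℝ) ^ p) * ∑ u : Fin n → Bool, Zw p S j u) := by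
    rw [← key, ← mul_assoc]
    exact mul_le_mul_of_nonneg_right hc hZ
  exact le_of_mul_le_mul_left hmain h2n

/-- the moment bound `Σ_u (1/2)^{#const blocks among first j} ≤ 2ⁿ (1 − 2^{−p})^j`. -/
theorem sum_Zw_le (h : ((∀ k k', k < k' → S k + p ≤ S k') ∧ (∀ k, S k + p ≤ n))) (hp : 1 ≤ p) : ∀ j, j ≤ M →
    ∑ u : Fin n → Bool, Zw p S j u ≤ (2 : ℝ) ^ n * (1 - (1 / 2 : ℝ) ^ p) ^ j := by
  intro j
  induction j with
  | zero =>
    intro _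
    have e : ∀ u : Fin n → Bool, Zw p S 0 u = 1 := fun u => by
      unfold Zw
      rw [cblkLT_zero, Finset.card_empty, pow_zero]
    simp_rw [e]
    rw [Finset.sum_const, Finset.card_univ, Fintype.card_fun, Fintype.card_bool, Fintype.card_fin, nsmul_eq_mul, mul_one,
      pow_zero, mul_one]
    push_cast
    exact le_refl _
  | succ j ih =>
    intro hj
    have hq : 0 ≤ 1 - (1 / 2 : ℝ) ^ p := by
      have : (1 / 2 : ℝ) ^ p ≤ 1 := pow_le_one₀ (by norm_num) (by norm_num)
      linarith
    calc ∑ u : Fin n → Bool, Zw p S (j + 1) u ≤ (1 - (1 / 2 : ℝ) ^ p) * ∑ u : Fin n → Bool, Zw p S j u :=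
          sum_Zw_succ_le h hp (by omega)
      _ ≤ (1 - (1 / 2 : ℝ) ^ p) * ((2 : ℝ) ^ n * (1 - (1 / 2 : ℝ) ^ p) ^ j) := mul_le_mul_of_nonneg_left (ih (by omega)) hq
      _ = (2 : ℝ) ^ n * (1 - (1 / 2 : ℝ) ^ p) ^ (j + 1) := by ring

/-- Markov: `#{u : at most T constant blocks} · (1/2)^T ≤ 2ⁿ (1 − 2^{−p})^M`. -/
theorem card_few_const_le (h : ((∀ k k', k < k' → S k + p ≤ S k') ∧ (∀ k, S k + p ≤ n))) (hp : 1 ≤ p) (T : ℕ) :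
    ((univ.filter fun u : Fin n → Bool => (cblk p S u).card ≤ T).card : ℝ) * (1 / 2 : ℝ) ^ T
      ≤ (2 : ℝ) ^ n * (1 - (1 / 2 : ℝ) ^ p) ^ M := by
  refine le_trans ?_ (sum_Zw_le h hp M le_rfl)
  have e : ((univ.filter fun u : Fin n → Bool => (cblk p S u).card ≤ T).card : ℝ) * (1 / 2 : ℝ) ^ T
      = ∑ _u ∈ univ.filter (fun u : Fin n → Bool => (cblk p S u).card ≤ T), (1 / 2 : ℝ) ^ T := by
    rw [Finset.sum_const, nsmul_eq_mul]
  rw [e]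
  calc ∑ _u ∈ univ.filter (fun u : Fin n → Bool => (cblk p S u).card ≤ T), (1 / 2 : ℝ) ^ T
      ≤ ∑ u ∈ univ.filter (fun u : Fin n → Bool => (cblk p S u).card ≤ T), Zw p S M u := by
        refine Finset.sum_le_sum fun u hu => ?_
        rw [mem_filter] at hu
        unfold Zw
        rw [cblkLT_M]
        exact pow_le_pow_of_le_one (by norm_num) (by norm_num) hu.2
    _ ≤ ∑ u, Zw p S M u :=
        Finset.sum_le_sum_of_subset_of_nonneg (filter_subset _ _) fun u _ _ => by unfold Zw; positivity

/-- `(1 − 2^{−p})^{2^p} ≤ e^{−1} ≤ 1/2`. -/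
theorem qpow_le_half (p : ℕ) : (1 - (1 / 2 : ℝ) ^ p) ^ (2 ^ p) ≤ 1 / 2 := by
  set x : ℝ := (1 / 2 : ℝ) ^ p with hx
  have hx1 : x ≤ 1 := pow_le_one₀ (by norm_num) (by norm_num)
  have h1 : 1 - x ≤ Real.exp (-x) := by linarith [Real.add_one_le_exp (-x)]
  have h2 : (1 - x) ^ (2 ^ p) ≤ Real.exp (-x) ^ (2 ^ p) := pow_le_pow_left₀ (by linarith) h1 _
  have h3 : Real.exp (-x) ^ (2 ^ p) = Real.exp (-1) := by
    rw [← Real.exp_nat_mul]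
    congr 1
    rw [hx]
    push_cast
    rw [show ((2 : ℝ) ^ p) * -((1 / 2 : ℝ) ^ p) = -(((2 : ℝ) * (1 / 2)) ^ p) by rw [mul_pow]; ring]
    norm_num
  have h4 : Real.exp (-1) ≤ 1 / 2 := by
    rw [Real.exp_neg, inv_eq_one_div]
    exact one_div_le_one_div_of_le (by norm_num) (by linarith [Real.add_one_le_exp (1 : ℝ)])
  calc (1 - x) ^ (2 ^ p) ≤ Real.exp (-x) ^ (2 ^ p) := h2
    _ = Real.exp (-1) := h3
    _ ≤ 1 / 2 := h4

/-- **THE CONSTANT-BLOCK TAIL**: with `M ≥ 2^p (T+1)` separated `p`-blocks, at most HALF of all inputs have `≤ T` constant blocks. -/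
theorem card_few_const_le_half (h : ((∀ k k', k < k' → S k + p ≤ S k') ∧ (∀ k, S k + p ≤ n))) (hp : 1 ≤ p) (T : ℕ) (hM : 2 ^ p * (T + 1) ≤ M) :
    ((univ.filter fun u : Fin n → Bool => (cblk p S u).card ≤ T).card : ℝ) ≤ (2 : ℝ) ^ n / 2 := by
  have h1 := card_few_const_le h hp T
  set q : ℝ := 1 - (1 / 2 : ℝ) ^ p with hq
  have hq0 : 0 ≤ q := by
    have : (1 / 2 : ℝ) ^ p ≤ 1 := pow_le_one₀ (by norm_num) (by norm_num)
    rw [hq]; linarith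
  have hq1 : q ≤ 1 := by
    have : (0 : ℝ) ≤ (1 / 2 : ℝ) ^ p := by positivity
    rw [hq]; linarith
  have hqM : q ^ M ≤ (1 / 2 : ℝ) ^ (T + 1) := by
    calc q ^ M ≤ q ^ (2 ^ p * (T + 1)) := pow_le_pow_of_le_one hq0 hq1 hM
      _ = (q ^ (2 ^ p)) ^ (T + 1) := pow_mul q (2 ^ p) (T + 1)
      _ ≤ (1 / 2 : ℝ) ^ (T + 1) := pow_le_pow_left₀ (by positivity) (qpow_le_half p) _
  have hT : (0 : ℝ) < (1 / 2 : ℝ) ^ T := by positivity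
  have hmain : ((univ.filter fun u : Fin n → Bool => (cblk p S u).card ≤ T).card : ℝ) * (1 / 2 : ℝ) ^ T
      ≤ ((2 : ℝ) ^ n / 2) * (1 / 2 : ℝ) ^ T := by
    calc _ ≤ (2 : ℝ) ^ n * q ^ M := h1
      _ ≤ (2 : ℝ) ^ n * (1 / 2 : ℝ) ^ (T + 1) := mul_le_mul_of_nonneg_left hqM (by positivity)
      _ = ((2 : ℝ) ^ n / 2) * (1 / 2 : ℝ) ^ T := by rw [pow_succ]; ring
  exact le_of_mul_le_mul_right hmain hT


end BlockTail

end Summit.QuantumAdvantage.AdviceFreeQNC0.JLinPeel.BlockDial
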